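import Mathlib
import Summits.Ventures.PercRepro2.TypedPairHarris

/-!
# Exact-state boxes and the provable four-point switching moves m3, m5, m8
(blind cell PercRepro2, p3 g9, 2026-08-26; `proofs/P3-SWITCH.md` §4–§5)

`typedCount_exact_box_le`: for a monotone state map `σ` into any preorder and states `α, β`, the
typed count of «`σ x = α`, `σ y = β`» (with a nonnegative spectator weight) is at most that of
«`σ x ≥ α` and `σ x ≥ β`, `σ y ≤ β` and `σ y ≤ α`» — the exact-state case of the box inequality
`PairHarris.typedCount_box_le`.  On a four-point side with the six connection bits
`σ x = (p~q, p~r, p~s, q~r, q~s, r~s)` this gives the three moves of P3-SWITCH §4 whose target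
is (everything connected, nothing connected): m5 `(pq|rs, pr|q|s)`, m3 `(pqr|s, ps|q|r)`,
m8 `(pq|rs, pr|qs)` (`typedCount_move5`, `typedCount_move3`, `typedCount_move8`; on realisable
states the right side is «`x` connects all four points, `y` none»).  Own work; standard axioms.
-/

namespace Summit.Ventures.PercRepro2

namespace CovForm

namespace PairHarris

open Classical

variable {E : Type*} [Fintype E] [DecidableEq E] {R : Type*} [Field R] [LinearOrder R]
  [IsStrictOrderedRing R]

/-- **Exact-state box** (with decidable instances on the state type): for a monotone state map
`σ` into a partial order, states `α, β`, a state `γ` with `(α ≤ s ∧ β ≤ s) ↔ γ ≤ s` and a state `δ`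
with `(s ≤ β ∧ s ≤ α) ↔ s = δ`: `#{σ x = α, σ y = β} ≤ #{γ ≤ σ x, σ y = δ}` with a nonnegative
spectator weight. -/
theorem typedCount_exact_box_le {S : Type*} [PartialOrder S] [DecidableEq S]
    [DecidableRel (α := S) (· ≤ ·)] (F : Finset E) (z : Config E)
    (τ : E → ℕ) (hτ : ∀ e ∈ F, τ e = 1 ∨ τ e = 2) (σ : Config E → S) (hσ : Monotone σ)
    (α β γ δ : S) (hγ : ∀ s : S, (α ≤ s ∧ β ≤ s) ↔ γ ≤ s) (hδ : ∀ s : S, (s ≤ β ∧ s ≤ α) ↔ s = δ)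
    (g : S → R) (hg : ∀ s, 0 ≤ g s) :
    typedCount F z τ (fun x y w => g (σ w) *
        ((if σ x = α then (1 : R) else 0) * (if σ y = β then (1 : R) else 0))) ≤
      typedCount F z τ (fun x y w => g (σ w) *
        ((if γ ≤ σ x then (1 : R) else 0) * (if σ y = δ then (1 : R) else 0))) := by
  have h := typedCount_box_le (R := R) F z τ hτ σ hσ α α β β g hg
  refine le_trans (le_of_eq (congrArg (typedCount F z τ) ?_))
    (h.trans (le_of_eq (congrArg (typedCount F z τ) ?_)))
  · funext x y w
    have e1 : (α ≤ σ x ∧ σ x ≤ α) ↔ σ x = α :=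
      ⟨fun ⟨h1, h2⟩ => le_antisymm h2 h1, fun hh => by rw [hh]; exact ⟨le_rfl, le_rfl⟩⟩
    have e2 : (β ≤ σ y ∧ σ y ≤ β) ↔ σ y = β :=
      ⟨fun ⟨h1, h2⟩ => le_antisymm h2 h1, fun hh => by rw [hh]; exact ⟨le_rfl, le_rfl⟩⟩
    simp only [e1, e2]
  · funext x y w
    simp only [hγ, hδ]

omit [Fintype E] [DecidableEq E] [LinearOrder R] [IsStrictOrderedRing R] in
/-- m5's join: `(pq, rs) ∨ (pr) = (pq, pr, rs)`. -/
lemma join_m5 (s : Bool × Bool × Bool × Bool × Bool × Bool) :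
    ((true, false, false, false, false, true) ≤ s ∧ (false, true, false, false, false, false) ≤ s) ↔
      (true, true, false, false, false, true) ≤ s := by
  rcases s with ⟨a, b, c, d, e, f⟩
  cases a <;> cases b <;> cases c <;> cases d <;> cases e <;> cases f <;> decide

omit [Fintype E] [DecidableEq E] [LinearOrder R] [IsStrictOrderedRing R] in
/-- m5's meet: `s ≤ (pr) ∧ s ≤ (pq, rs) ↔ s = ⊥`. -/
lemma meet_m5 (s : Bool × Bool × Bool × Bool × Bool × Bool) :
    (s ≤ (false, true, false, false, false, false) ∧ s ≤ (true, false, false, false, false, true)) ↔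
      s = (false, false, false, false, false, false) := by
  rcases s with ⟨a, b, c, d, e, f⟩
  cases a <;> cases b <;> cases c <;> cases d <;> cases e <;> cases f <;> decide

omit [Fintype E] [DecidableEq E] [LinearOrder R] [IsStrictOrderedRing R] in
/-- m3's join: `(pq, pr, qr) ∨ (ps) = (pq, pr, ps, qr)`. -/
lemma join_m3 (s : Bool × Bool × Bool × Bool × Bool × Bool) :
    ((true, true, false, true, false, false) ≤ s ∧ (false, false, true, false, false, false) ≤ s) ↔
      (true, true, true, true, false, false) ≤ s := by
  rcases s with ⟨a, b, c, d, e, f⟩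
  cases a <;> cases b <;> cases c <;> cases d <;> cases e <;> cases f <;> decide

omit [Fintype E] [DecidableEq E] [LinearOrder R] [IsStrictOrderedRing R] in
/-- m3's meet: `s ≤ (ps) ∧ s ≤ (pq, pr, qr) ↔ s = ⊥`. -/
lemma meet_m3 (s : Bool × Bool × Bool × Bool × Bool × Bool) :
    (s ≤ (false, false, true, false, false, false) ∧ s ≤ (true, true, false, true, false, false)) ↔
      s = (false, false, false, false, false, false) := by
  rcases s with ⟨a, b, c, d, e, f⟩
  cases a <;> cases b <;> cases c <;> cases d <;> cases e <;> cases f <;> decide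

omit [Fintype E] [DecidableEq E] [LinearOrder R] [IsStrictOrderedRing R] in
/-- m8's join: `(pq, rs) ∨ (pr, qs) = (pq, pr, qs, rs)`. -/
lemma join_m8 (s : Bool × Bool × Bool × Bool × Bool × Bool) :
    ((true, false, false, false, false, true) ≤ s ∧ (false, true, false, false, true, false) ≤ s) ↔
      (true, true, false, false, true, true) ≤ s := by
  rcases s with ⟨a, b, c, d, e, f⟩
  cases a <;> cases b <;> cases c <;> cases d <;> cases e <;> cases f <;> decide

omit [Fintype E] [DecidableEq E] [LinearOrder R] [IsStrictOrderedRing R] in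
/-- m8's meet: `s ≤ (pr, qs) ∧ s ≤ (pq, rs) ↔ s = ⊥`. -/
lemma meet_m8 (s : Bool × Bool × Bool × Bool × Bool × Bool) :
    (s ≤ (false, true, false, false, true, false) ∧ s ≤ (true, false, false, false, false, true)) ↔
      s = (false, false, false, false, false, false) := by
  rcases s with ⟨a, b, c, d, e, f⟩
  cases a <;> cases b <;> cases c <;> cases d <;> cases e <;> cases f <;> decide

/-- **m5** `(pq|rs, pr|q|s) → (pqrs, SEP)`: `#{σ x = (pq, rs), σ y = (pr)} ≤ #{σ x ≥ (pq, pr, rs), σ y = ⊥}`. -/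
theorem typedCount_move5 (F : Finset E) (z : Config E) (τ : E → ℕ)
    (hτ : ∀ e ∈ F, τ e = 1 ∨ τ e = 2) (σ : Config E → Bool × Bool × Bool × Bool × Bool × Bool) (hσ : Monotone σ)
    (g : Bool × Bool × Bool × Bool × Bool × Bool → R) (hg : ∀ s, 0 ≤ g s) :
    typedCount F z τ (fun x y w => g (σ w) *
        ((if σ x = (true, false, false, false, false, true) then (1 : R) else 0) *
          (if σ y = (false, true, false, false, false, false) then (1 : R) else 0))) ≤
      typedCount F z τ (fun x y w => g (σ w) *
        ((if (true, true, false, false, false, true) ≤ σ x then (1 : R) else 0) *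
          (if σ y = (false, false, false, false, false, false) then (1 : R) else 0))) :=
  typedCount_exact_box_le (R := R) F z τ hτ σ hσ (true, false, false, false, false, true) (false, true, false, false, false, false) _ _ join_m5 meet_m5 g hg

/-- **m3** `(pqr|s, ps|q|r) → (pqrs, SEP)`. -/
theorem typedCount_move3 (F : Finset E) (z : Config E) (τ : E → ℕ)
    (hτ : ∀ e ∈ F, τ e = 1 ∨ τ e = 2) (σ : Config E → Bool × Bool × Bool × Bool × Bool × Bool) (hσ : Monotone σ)
    (g : Bool × Bool × Bool × Bool × Bool × Bool → R) (hg : ∀ s, 0 ≤ g s) :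
    typedCount F z τ (fun x y w => g (σ w) *
        ((if σ x = (true, true, false, true, false, false) then (1 : R) else 0) *
          (if σ y = (false, false, true, false, false, false) then (1 : R) else 0))) ≤
      typedCount F z τ (fun x y w => g (σ w) *
        ((if (true, true, true, true, false, false) ≤ σ x then (1 : R) else 0) *
          (if σ y = (false, false, false, false, false, false) then (1 : R) else 0))) :=
  typedCount_exact_box_le (R := R) F z τ hτ σ hσ (true, true, false, true, false, false) (false, false, true, false, false, false) _ _ join_m3 meet_m3 g hg

/-- **m8** `(pq|rs, pr|qs) → (pqrs, SEP)`. -/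
theorem typedCount_move8 (F : Finset E) (z : Config E) (τ : E → ℕ)
    (hτ : ∀ e ∈ F, τ e = 1 ∨ τ e = 2) (σ : Config E → Bool × Bool × Bool × Bool × Bool × Bool) (hσ : Monotone σ)
    (g : Bool × Bool × Bool × Bool × Bool × Bool → R) (hg : ∀ s, 0 ≤ g s) :
    typedCount F z τ (fun x y w => g (σ w) *
        ((if σ x = (true, false, false, false, false, true) then (1 : R) else 0) *
          (if σ y = (false, true, false, false, true, false) then (1 : R) else 0))) ≤
      typedCount F z τ (fun x y w => g (σ w) *
        ((if (true, true, false, false, true, true) ≤ σ x then (1 : R) else 0) *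
          (if σ y = (false, false, false, false, false, false) then (1 : R) else 0))) :=
  typedCount_exact_box_le (R := R) F z τ hτ σ hσ (true, false, false, false, false, true) (false, true, false, false, true, false) _ _ join_m8 meet_m8 g hg

end PairHarris

end CovForm

end Summit.Ventures.PercRepro2
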